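import Mathlib
import Summits.ValiantsHypothesis.ValiantsHypothesis.Theorems.LiouvilleSarnakAlignedCutRank
import Summits.ValiantsHypothesis.ValiantsHypothesis.Theorems.LiouvilleSarnakLiouvilleCutRankSignPatternsTools

/-!
# Route LiouvilleSarnak — crux `LiouvilleCutRank` (stmt-ValiantsHypothesis-14775):
# the FINELY INTERLEAVED prototype `(CR)^n` and SPARSE KERNEL DISTINCTNESS

After `Theorems/LiouvilleSarnakCutRankAlignedWindow.lean`, `…StrayWindows{,Bottom}.lean`,
`…SeparatedBlocks.lean` and `…LongRun.lean`, a cut word of rank `< W` has no two long opposite runs at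
bounded distance and no run of length `n₁ - O(1)`: the open core of the crux is the class of FINELY
INTERLEAVED words, prototype the bit-interleaving `(CR)^n` (column bit `2i`, row bit `2i+1`), whose cut
matrix is `M(r, c) = λ(2·P(r) + P(c) + 1)` with `P(v) = Σ_i [v i] 4^i` (base-`4` numbers with digits in
`{0,1}`: a Cantor-type set `D` of dimension `1/2`).

This file proves the analogue, for this prototype, of the kernel argument that settled the aligned rung
(`LiouvilleSarnakAligned.alignedCutRank_proof`): the rows `ρ ∈ {0,1}^j` of `M` (higher row digits `0`),
read on the columns `c = (γ, x)` with FROZEN low digits `γ` and free high digits `x ∈ {0,1}^L`, are the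
`4`-kernel elements `x ↦ λ(4^j x + q)`, `q = 2 P(ρ) + P(γ) + 1`, RESTRICTED TO THE SPARSE SET `D`:

* `cutNumber_interleaved` — for the interleaved cut, `N_π(r, c) = 2 P(r) + P(c)`.
* ★ `le_rank_interleaved_of_sparseKernel` — if for some `j, L, γ` more than `2^W` residues
  `q = 2 P(ρ) + P(γ) + 1` (`ρ ∈ {0,1}^j`) give PAIRWISE DISTINCT functions `x ↦ λ(4^j P(x) + q)` on
  `{0,1}^L`, then the interleaved cut matrix at level `j + L` has rank `> W`.

So the arithmetic input that would settle the prototype is SPARSE KERNEL DISTINCTNESS: infinitely many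
`4`-kernel elements of `λ` (with residues sharing their column digits) stay pairwise distinct when sampled
only along the digit-restricted set `D` — a "non-automaticity along a Cantor set".  Coons /
Schlage-Puchta's van-der-Waerden-and-division argument (tree:
`Literature.NumberTheory.LFunctions.LiouvilleNotAutomaticProofs`) does not transfer (`D` has no
three-term progressions and is not stable under division), which is why this case is OPEN.

Honest framing: a proved REDUCTION for the prototype of the open class, no new case of the crux; the crux
`LiouvilleCutRank`, `DigitalBilinearLiouville` and `AlgebraicSarnak` stay OPEN; nothing here bears on VP
versus VNP.  No definitions. [cite: Coons2011, Theorem 1.5] [cite: AlloucheShallit2003, §6.6]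
-/

-- the directory `ValiantsHypothesis/ValiantsHypothesis` repeats the summit name (tree layout)
set_option linter.dupNamespace false

noncomputable section

namespace Summit.ValiantsHypothesis.ValiantsHypothesis.Theorems.LiouvilleSarnakLiouvilleCutRank.Interleaved

open ArithmeticFunction Finset

open Summit.ValiantsHypothesis.ValiantsHypothesis.Theorems.LiouvilleSarnakAligned
  (card_image_row_le_two_pow_rank)
open Summit.ValiantsHypothesis.ValiantsHypothesis.Theorems.LiouvilleSarnakLiouvilleCutRank.SignPatterns
  (ofBits_cut_eq_add ofBits_rows_eq_sum ofBits_cols_eq_sum)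

/-! ### §1 The interleaved cut number -/

/-- For the bit-interleaving cut (row bit `i` at position `2i+1`, column bit `i` at position `2i`),
`N_π(r, c) = 2 · Σ_i [r i] 4^i + Σ_i [c i] 4^i`. [folklore] -/
theorem cutNumber_interleaved (n : ℕ) (π : Fin n ⊕ Fin n ≃ Fin (2 * n))
    (hπ : ∀ i : Fin n, (π (Sum.inl i) : ℕ) = 2 * i + 1 ∧ (π (Sum.inr i) : ℕ) = 2 * i)
    (r c : Fin n → Bool) :
    Nat.ofBits (fun j : Fin (2 * n) => Sum.elim r c (π.symm j)) =
      2 * (∑ i : Fin n, (r i).toNat * 4 ^ (i : ℕ)) + ∑ i : Fin n, (c i).toNat * 4 ^ (i : ℕ) := by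
  rw [ofBits_cut_eq_add, ofBits_rows_eq_sum, ofBits_cols_eq_sum, Finset.mul_sum]
  congr 1
  · refine Finset.sum_congr rfl fun i _ => ?_
    rw [(hπ i).1, pow_succ, pow_mul]
    norm_num
    ring
  · refine Finset.sum_congr rfl fun i _ => ?_
    rw [(hπ i).2, pow_mul]
    norm_num

/-- The bit-interleaving cut exists at every level (non-vacuity of the hypothesis `hπ` below).
[folklore] -/
theorem exists_interleavedCut (n : ℕ) : ∃ π : Fin n ⊕ Fin n ≃ Fin (2 * n),
    ∀ i : Fin n, (π (Sum.inl i) : ℕ) = 2 * i + 1 ∧ (π (Sum.inr i) : ℕ) = 2 * i := by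
  let f : Fin n ⊕ Fin n → Fin (2 * n) := fun x =>
    Sum.elim (fun i : Fin n => (⟨2 * (i : ℕ) + 1, by omega⟩ : Fin (2 * n)))
      (fun i : Fin n => (⟨2 * (i : ℕ), by omega⟩ : Fin (2 * n))) x
  have hinj : Function.Injective f := by
    rintro (i | i) (i' | i') h <;>
      simp only [f, Sum.elim_inl, Sum.elim_inr, Fin.mk.injEq] at h
    · have : i = i' := Fin.ext (by omega)
      rw [this]
    · omega
    · omega
    · have : i = i' := Fin.ext (by omega)
      rw [this]
  have hbij : Function.Bijective f := by
    rw [Fintype.bijective_iff_injective_and_card]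
    refine ⟨hinj, ?_⟩
    simp only [Fintype.card_sum, Fintype.card_fin]
    omega
  exact ⟨Equiv.ofBijective f hbij, fun i => ⟨rfl, rfl⟩⟩

/-! ### §2 Digit sums of appended strings -/

/-- `P(ρ ++ 0) = P(ρ)`. [folklore] -/
theorem digits_append_zero (j L : ℕ) (ρ : Fin j → Bool) :
    (∑ i : Fin (j + L), (Fin.append ρ (fun _ : Fin L => false) i).toNat * 4 ^ (i : ℕ)) =
      ∑ i : Fin j, (ρ i).toNat * 4 ^ (i : ℕ) := by
  rw [Fin.sum_univ_add]
  simp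

/-- `P(γ ++ x) = P(γ) + 4^j P(x)`. [folklore] -/
theorem digits_append (j L : ℕ) (γ : Fin j → Bool) (x : Fin L → Bool) :
    (∑ i : Fin (j + L), (Fin.append γ x i).toNat * 4 ^ (i : ℕ)) =
      (∑ i : Fin j, (γ i).toNat * 4 ^ (i : ℕ)) + 4 ^ j * ∑ i : Fin L, (x i).toNat * 4 ^ (i : ℕ) := by
  rw [Fin.sum_univ_add, Finset.mul_sum]
  simp only [Fin.append_left, Fin.append_right, Fin.val_castAdd, Fin.val_natAdd]
  congr 1
  refine Finset.sum_congr rfl fun i _ => ?_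
  rw [pow_add, ← Nat.mul_assoc, Nat.mul_comm ((x i).toNat) (4 ^ j), Nat.mul_assoc]

/-! ### §3 Sparse kernel distinctness gives rank -/

/-- ★ **Sparse kernel distinctness ⟹ rank of the interleaved cut.**  Let `π` be the bit-interleaving
cut at level `j + L`.  If for some frozen low column digits `γ ∈ {0,1}^j` a set `S` of more than `2^W`
low row digit strings `ρ ∈ {0,1}^j` gives PAIRWISE DISTINCT restricted kernel functions
`x ↦ λ(4^j P(x) + 2 P(ρ) + P(γ) + 1)` on `x ∈ {0,1}^L` (`P(v) = Σ_i [v i] 4^i`), then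
`rank M_π > W`: these functions are rows of `M_π` (row `ρ ++ 0`, columns `γ ++ x`), pairwise distinct,
and a `±1` matrix with more than `2^W` distinct rows has rank `> W`
(`LiouvilleSarnakAligned.card_image_row_le_two_pow_rank`). [cite: AlloucheShallit2003, §6.6] -/
theorem le_rank_interleaved_of_sparseKernel (W j L : ℕ)
    (π : Fin (j + L) ⊕ Fin (j + L) ≃ Fin (2 * (j + L)))
    (hπ : ∀ i : Fin (j + L), (π (Sum.inl i) : ℕ) = 2 * i + 1 ∧ (π (Sum.inr i) : ℕ) = 2 * i)
    (γ : Fin j → Bool) (S : Finset (Fin j → Bool)) (hS : 2 ^ W < S.card)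
    (hdist : ∀ ρ ∈ S, ∀ ρ' ∈ S, ρ ≠ ρ' → ∃ x : Fin L → Bool,
      liouville (4 ^ j * (∑ i : Fin L, (x i).toNat * 4 ^ (i : ℕ)) +
          (2 * (∑ i : Fin j, (ρ i).toNat * 4 ^ (i : ℕ)) + (∑ i : Fin j, (γ i).toNat * 4 ^ (i : ℕ)) + 1)) ≠
        liouville (4 ^ j * (∑ i : Fin L, (x i).toNat * 4 ^ (i : ℕ)) +
          (2 * (∑ i : Fin j, (ρ' i).toNat * 4 ^ (i : ℕ)) + (∑ i : Fin j, (γ i).toNat * 4 ^ (i : ℕ)) + 1))) :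
    W + 1 ≤ (Matrix.of fun r c : Fin (j + L) → Bool =>
      (((liouville (Nat.ofBits (fun k : Fin (2 * (j + L)) => Sum.elim r c (π.symm k)) + 1) : ℤ) :
        ℂ))).rank := by
  classical
  set M := (Matrix.of fun r c : Fin (j + L) → Bool =>
      (((liouville (Nat.ofBits (fun k : Fin (2 * (j + L)) => Sum.elim r c (π.symm k)) + 1) : ℤ) :
        ℂ))) with hM
  -- entries are `±1`
  have hpm : ∀ r c, M r c = 1 ∨ M r c = -1 := by
    intro r c
    rw [hM, Matrix.of_apply, liouville_apply (Nat.succ_ne_zero _)]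
    rcases neg_one_pow_eq_or ℤ
        (cardFactors (Nat.ofBits (fun k : Fin (2 * (j + L)) => Sum.elim r c (π.symm k)) + 1))
      with h | h
    · left; rw [h]; norm_num
    · right; rw [h]; norm_num
  -- the entry in row `ρ ++ 0`, column `γ ++ x`
  have hentry : ∀ (ρ : Fin j → Bool) (x : Fin L → Bool),
      M (Fin.append ρ fun _ => false) (Fin.append γ x) =
        ((liouville (4 ^ j * (∑ i : Fin L, (x i).toNat * 4 ^ (i : ℕ)) +
          (2 * (∑ i : Fin j, (ρ i).toNat * 4 ^ (i : ℕ)) + (∑ i : Fin j, (γ i).toNat * 4 ^ (i : ℕ)) +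
            1)) : ℤ) : ℂ) := by
    intro ρ x
    rw [hM, Matrix.of_apply, cutNumber_interleaved (j + L) π hπ, digits_append_zero, digits_append]
    generalize (∑ i : Fin j, (ρ i).toNat * 4 ^ (i : ℕ)) = A
    generalize (∑ i : Fin j, (γ i).toNat * 4 ^ (i : ℕ)) = B
    generalize (∑ i : Fin L, (x i).toNat * 4 ^ (i : ℕ)) = C
    rw [show 2 * A + (B + 4 ^ j * C) + 1 = 4 ^ j * C + (2 * A + B + 1) by ring]
  -- the rows `ρ ++ 0`, `ρ ∈ S`, are pairwise distinct
  have hinj : Set.InjOn (fun ρ : Fin j → Bool => M (Fin.append ρ fun _ => false)) ↑S := by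
    intro ρ hρ ρ' hρ' h
    by_contra hne
    obtain ⟨x, hx⟩ := hdist ρ hρ ρ' hρ' hne
    apply hx
    have h1 := congrFun h (Fin.append γ x)
    simp only at h1
    rw [hentry, hentry] at h1
    exact_mod_cast h1
  -- count distinct rows
  have hcard : S.card ≤ (Finset.univ.image fun r : Fin (j + L) → Bool => M r).card := by
    calc S.card = (S.image fun ρ : Fin j → Bool => M (Fin.append ρ fun _ => false)).card :=
          (Finset.card_image_of_injOn hinj).symm
      _ ≤ (Finset.univ.image fun r : Fin (j + L) → Bool => M r).card := by
          refine Finset.card_le_card fun v hv => ?_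
          obtain ⟨ρ, -, rfl⟩ := Finset.mem_image.mp hv
          exact Finset.mem_image.mpr ⟨_, Finset.mem_univ _, rfl⟩
  have hrank := card_image_row_le_two_pow_rank M hpm
  have hlt : 2 ^ W < 2 ^ M.rank := lt_of_lt_of_le hS (hcard.trans hrank)
  exact Nat.succ_le_of_lt ((Nat.pow_lt_pow_iff_right (by norm_num)).mp hlt)

end Summit.ValiantsHypothesis.ValiantsHypothesis.Theorems.LiouvilleSarnakLiouvilleCutRank.Interleaved

end
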